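import Mathlib.Analysis.CStarAlgebra.Spectrum
import Mathlib.Analysis.CStarAlgebra.ContinuousLinearMap
import Mathlib.Analysis.Normed.Operator.Extend
import Mathlib.Analysis.InnerProductSpace.Projection.Submodule
import Mathlib.Analysis.Calculus.MeanValue
import Literature.Barriers.QuantumFields.GoldstoneTheorem
import HarnessLib

/-!
# Goldstone's theorem (Kastler–Robinson–Swieca) — the unitary implementation, §IV

Companion to `Literature/Barriers/QuantumFields/GoldstoneTheorem.lean`, which vendors the
framework (`LocalNetWithCurrent`, `IsKRS`, `IsLocallyGeneratedSymmetry`) and the named facts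
`KRSLemmaIV`, `GoldstoneTheorem` of Kastler–Robinson–Swieca, *Conserved currents and associated
symmetries; Goldstone's theorem*, Commun. Math. Phys. **2** (1966) 108–120.

This file proves §IV of the paper (pp. 117–118): the Theorem (56)–(59) follows from assumptions
1.–6. and Lemma IV. Printed architecture, followed here:
* (70)–(71): by 6(b) and Lemma IV, `d/dτ (Ω, A^τ Ω)|_{τ=0} = 0` for strictly local `A`; by the
  group law and 6(a) (`A^{τ₀}` is again strictly local) the derivative vanishes at every `τ₀`, so
  `(Ω, A^τ Ω) = (Ω, A Ω)` (60) for strictly local `A`, and for all `A ∈ 𝔄` "because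
  `|ω(a)| ≤ ‖a‖` and every `a ∈ 𝔄` is the limit in the norm topology of strictly local elements"
  (`vev_invariant_of_hasDerivAt`; the norm continuity of the automorphism is the automatic
  contractivity of *-homomorphisms of C*-algebras, Mathlib's `NonUnitalStarAlgHom.norm_apply_le`
  applied to the norm-closed star subalgebra `𝔄 ⊆ B(H)`, `norm_apply_le`).
* (61)–(69), GNS: `U(τ) A Ω := A^τ Ω` is "coherently determined as a unitary operator" since
  `(U(τ)â, U(τ)b̂) = ω((a^τ)* b^τ) = ω((a* b)^τ) = ω(a* b)` (67) (`norm_apply_vacuum_eq`), on the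
  dense subspace `𝔄 Ω` — dense because `Ω` is cyclic, which we derive from the irreducibility in
  assumption 1. (`denseRange_vacuumVector`: the projection onto the closure of `𝔄 Ω` commutes
  with all strictly local operators, hence is a scalar fixing `Ω`); the extension to `H` is
  Mathlib's `LinearEquiv.extendOfIsometry`. Then (56) `A^τ = U(τ) A U(τ)⁻¹`, (57), (58) and (59)
  `U(τ) Ω = Ω` ("because `Ω = ê` and `ê^τ = ê`", `IsLocallyGeneratedSymmetry.map_one`) are checked
  on `𝔄 Ω` (`exists_unitary_implementation`).

Main results: `goldstone_of_hasDerivAt_vev` (the Theorem from the vanishing of the order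
parameter `d/dτ (Ω, A^τ Ω)|₀` for strictly local `A`) and `goldstoneTheorem_of_KRSLemmaIV :
KRSLemmaIV → GoldstoneTheorem`. Strong continuity of `τ ↦ U(τ)` ((69)) is not part of the vendored
statement and is not proved here.

## References

[KastlerRobinsonSwieca1966]
-/

noncomputable section

open Filter Topology ComplexConjugate
open scoped InnerProductSpace

namespace Literature.Barriers.QuantumFields

open Literature.MathematicalPhysics.QuantumLattice LocalNetWithCurrent

namespace LocalNetWithCurrent

variable (N : LocalNetWithCurrent)

/-- The strictly local operators `⋃_L 𝔄(𝒪_L)` form a star subalgebra of `B(H)` when the net is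
isotone (KRS §II 1.: "the set theoretic union of all `𝔄(𝒪)` is a normed *-algebra"; the double
cones `𝒪_L` are cofinal among bounded regions). [cite: KastlerRobinsonSwieca1966, §II 1.] -/
def strictlyLocalAlgebra
    (hiso : ∀ O₁ O₂ : Set (SpaceTime 3), O₁ ⊆ O₂ → N.alg O₁ ≤ N.alg O₂) :
    StarSubalgebra ℂ (N.H →L[ℂ] N.H) where
  carrier := {A | N.IsStrictlyLocal A}
  mul_mem' := by
    rintro A B ⟨L₁, h₁⟩ ⟨L₂, h₂⟩
    exact ⟨max L₁ L₂, mul_mem (hiso _ _ (krsDiamond_mono (le_max_left _ _)) h₁)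
      (hiso _ _ (krsDiamond_mono (le_max_right _ _)) h₂)⟩
  one_mem' := ⟨0, one_mem _⟩
  add_mem' := by
    rintro A B ⟨L₁, h₁⟩ ⟨L₂, h₂⟩
    exact ⟨max L₁ L₂, add_mem (hiso _ _ (krsDiamond_mono (le_max_left _ _)) h₁)
      (hiso _ _ (krsDiamond_mono (le_max_right _ _)) h₂)⟩
  zero_mem' := ⟨0, zero_mem _⟩
  algebraMap_mem' c := ⟨0, algebraMap_mem _ c⟩
  star_mem' := by
    rintro A ⟨L, h⟩
    exact ⟨L, star_mem h⟩

/-- The quasi-local algebra `𝔄` as a norm-closed star subalgebra of `B(H)` (a C*-algebra of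
operators): the closure of the strictly local star subalgebra; its underlying set is
`LocalNetWithCurrent.quasiLocal`. [cite: KastlerRobinsonSwieca1966, §II 1.] -/
def quasiLocalAlgebra
    (hiso : ∀ O₁ O₂ : Set (SpaceTime 3), O₁ ⊆ O₂ → N.alg O₁ ≤ N.alg O₂) :
    StarSubalgebra ℂ (N.H →L[ℂ] N.H) :=
  (N.strictlyLocalAlgebra hiso).topologicalClosure

/-- Membership in `quasiLocalAlgebra` is membership in `quasiLocal`. [folklore] -/
theorem mem_quasiLocalAlgebra_iff
    (hiso : ∀ O₁ O₂ : Set (SpaceTime 3), O₁ ⊆ O₂ → N.alg O₁ ≤ N.alg O₂) (A : N.H →L[ℂ] N.H) :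
    A ∈ N.quasiLocalAlgebra hiso ↔ A ∈ N.quasiLocal := Iff.rfl

/-- The quasi-local algebra is norm closed (hence a C*-algebra, Mathlib's
`StarSubalgebra.cstarAlgebra`). [folklore] -/
theorem isClosed_quasiLocalAlgebra
    (hiso : ∀ O₁ O₂ : Set (SpaceTime 3), O₁ ⊆ O₂ → N.alg O₁ ≤ N.alg O₂) :
    IsClosed (N.quasiLocalAlgebra hiso : Set (N.H →L[ℂ] N.H)) := isClosed_closure

/-- `1 ∈ 𝔄` (`1 ∈ 𝔄(𝒪_0)`). [folklore] -/
theorem one_mem_quasiLocal : (1 : N.H →L[ℂ] N.H) ∈ N.quasiLocal :=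
  N.subset_quasiLocal ⟨0, one_mem _⟩

/-- `0 ∈ 𝔄`. [folklore] -/
theorem zero_mem_quasiLocal : (0 : N.H →L[ℂ] N.H) ∈ N.quasiLocal :=
  N.subset_quasiLocal ⟨0, zero_mem _⟩

variable {N}

/-- `𝔄` is closed under adjoints. [folklore] -/
theorem star_mem_quasiLocal
    (hiso : ∀ O₁ O₂ : Set (SpaceTime 3), O₁ ⊆ O₂ → N.alg O₁ ≤ N.alg O₂)
    {A : N.H →L[ℂ] N.H} (hA : A ∈ N.quasiLocal) : star A ∈ N.quasiLocal :=
  (star_mem (s := N.quasiLocalAlgebra hiso) hA :)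

/-- `𝔄` is closed under products. [folklore] -/
theorem mul_mem_quasiLocal
    (hiso : ∀ O₁ O₂ : Set (SpaceTime 3), O₁ ⊆ O₂ → N.alg O₁ ≤ N.alg O₂)
    {A B : N.H →L[ℂ] N.H} (hA : A ∈ N.quasiLocal) (hB : B ∈ N.quasiLocal) :
    A * B ∈ N.quasiLocal :=
  (mul_mem (s := N.quasiLocalAlgebra hiso) hA hB :)

/-- `𝔄` is closed under differences. [folklore] -/
theorem sub_mem_quasiLocal
    (hiso : ∀ O₁ O₂ : Set (SpaceTime 3), O₁ ⊆ O₂ → N.alg O₁ ≤ N.alg O₂)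
    {A B : N.H →L[ℂ] N.H} (hA : A ∈ N.quasiLocal) (hB : B ∈ N.quasiLocal) :
    A - B ∈ N.quasiLocal :=
  (sub_mem (show A ∈ N.quasiLocalAlgebra hiso from hA) (show B ∈ N.quasiLocalAlgebra hiso from hB) :)

variable {α : ℝ → (N.H →L[ℂ] N.H) → (N.H →L[ℂ] N.H)}

namespace IsLocallyGeneratedSymmetry

/-- `α_τ(0) = 0`. [folklore] -/
theorem map_zero (hα : N.IsLocallyGeneratedSymmetry α) (τ : ℝ) : α τ 0 = 0 := by
  have h := hα.map_smul τ (0 : ℂ) 0 N.zero_mem_quasiLocal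
  simpa using h

/-- `α_τ(-A) = -α_τ(A)` on `𝔄`. [folklore] -/
theorem map_neg (hα : N.IsLocallyGeneratedSymmetry α) (τ : ℝ) {A : N.H →L[ℂ] N.H}
    (hA : A ∈ N.quasiLocal) : α τ (-A) = -α τ A := by
  have h := hα.map_smul τ (-1 : ℂ) A hA
  simpa using h

/-- `α_τ(A - B) = α_τ(A) - α_τ(B)` on `𝔄`. [folklore] -/
theorem map_sub (hα : N.IsLocallyGeneratedSymmetry α)
    (hiso : ∀ O₁ O₂ : Set (SpaceTime 3), O₁ ⊆ O₂ → N.alg O₁ ≤ N.alg O₂) (τ : ℝ)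
    {A B : N.H →L[ℂ] N.H} (hA : A ∈ N.quasiLocal) (hB : B ∈ N.quasiLocal) :
    α τ (A - B) = α τ A - α τ B := by
  have hnB : -B ∈ N.quasiLocal := (neg_mem (s := N.quasiLocalAlgebra hiso) hB :)
  rw [sub_eq_add_neg, hα.map_add τ A hA (-B) hnB, hα.map_neg τ hB, ← sub_eq_add_neg]

/-- `α_τ(1) = 1`: a bijective multiplicative map of the unital algebra `𝔄` onto itself preserves
the unit (KRS: "`ê^τ = ê`, where `e` is the unit element of `𝔄`").
[cite: KastlerRobinsonSwieca1966, §IV (after (69))] -/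
theorem map_one (hα : N.IsLocallyGeneratedSymmetry α) (τ : ℝ) : α τ 1 = 1 := by
  have h1 : (1 : N.H →L[ℂ] N.H) ∈ N.quasiLocal := N.one_mem_quasiLocal
  have hB : α (-τ) 1 ∈ N.quasiLocal := hα.maps_quasiLocal _ _ h1
  have hτB : α τ (α (-τ) 1) = 1 := by
    rw [← hα.map_add_left τ (-τ) 1 h1, add_neg_cancel, hα.map_zero_left 1 h1]
  calc α τ 1 = α τ 1 * α τ (α (-τ) 1) := by rw [hτB, mul_one]
    _ = α τ (1 * α (-τ) 1) := (hα.map_mul τ 1 h1 _ hB).symm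
    _ = 1 := by rw [one_mul, hτB]

/-- Group law: `α_{-τ} (α_τ A) = A` on `𝔄`. [folklore] -/
theorem apply_neg_apply (hα : N.IsLocallyGeneratedSymmetry α) (τ : ℝ) {A : N.H →L[ℂ] N.H}
    (hA : A ∈ N.quasiLocal) : α (-τ) (α τ A) = A := by
  rw [← hα.map_add_left (-τ) τ A hA, neg_add_cancel, hα.map_zero_left A hA]

/-- Group law: `α_τ (α_{-τ} A) = A` on `𝔄`. [folklore] -/
theorem apply_apply_neg (hα : N.IsLocallyGeneratedSymmetry α) (τ : ℝ) {A : N.H →L[ℂ] N.H}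
    (hA : A ∈ N.quasiLocal) : α τ (α (-τ) A) = A := by
  rw [← hα.map_add_left τ (-τ) A hA, add_neg_cancel, hα.map_zero_left A hA]

/-- An automorphism of the quasi-local C*-algebra is norm-contractive: `‖α_τ(A)‖ ≤ ‖A‖` for
`A ∈ 𝔄` — the automatic continuity of *-homomorphisms between C*-algebras (Mathlib:
`NonUnitalStarAlgHom.norm_apply_le`), which KRS use in (69) and in "`|ω(a)| ≤ ‖a‖` and every
`a ∈ 𝔄` is the limit … of strictly local elements". [folklore] -/
theorem norm_apply_le (hα : N.IsLocallyGeneratedSymmetry α)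
    (hiso : ∀ O₁ O₂ : Set (SpaceTime 3), O₁ ⊆ O₂ → N.alg O₁ ≤ N.alg O₂) (τ : ℝ)
    {A : N.H →L[ℂ] N.H} (hA : A ∈ N.quasiLocal) : ‖α τ A‖ ≤ ‖A‖ := by
  set S := N.quasiLocalAlgebra hiso
  haveI : IsClosed (S : Set (N.H →L[ℂ] N.H)) := N.isClosed_quasiLocalAlgebra hiso
  let φ : S →⋆ₙₐ[ℂ] S :=
    { toFun := fun B => ⟨α τ B, hα.maps_quasiLocal τ B B.2⟩
      map_smul' := fun c B => Subtype.ext (by simpa using hα.map_smul τ c B B.2)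
      map_zero' := Subtype.ext (by simpa using hα.map_zero τ)
      map_add' := fun B C => Subtype.ext (by simpa using hα.map_add τ B B.2 C C.2)
      map_mul' := fun B C => Subtype.ext (by simpa using hα.map_mul τ B B.2 C C.2)
      map_star' := fun B => Subtype.ext (by simpa using hα.map_star τ B B.2) }
  exact NonUnitalStarAlgHom.norm_apply_le φ ⟨A, hA⟩

/-- Norm continuity of `A ↦ α_τ(A)` along sequences in `𝔄`. [folklore] -/
theorem tendsto_apply (hα : N.IsLocallyGeneratedSymmetry α)
    (hiso : ∀ O₁ O₂ : Set (SpaceTime 3), O₁ ⊆ O₂ → N.alg O₁ ≤ N.alg O₂) (τ : ℝ)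
    {u : ℕ → (N.H →L[ℂ] N.H)} (hu : ∀ n, u n ∈ N.quasiLocal) {A : N.H →L[ℂ] N.H}
    (hA : A ∈ N.quasiLocal) (h : Tendsto u atTop (𝓝 A)) :
    Tendsto (fun n => α τ (u n)) atTop (𝓝 (α τ A)) := by
  rw [tendsto_iff_norm_sub_tendsto_zero] at h ⊢
  refine squeeze_zero (fun n => norm_nonneg _) (fun n => ?_) h
  rw [← hα.map_sub hiso τ (hu n) hA]
  exact hα.norm_apply_le hiso τ (N.sub_mem_quasiLocal hiso (hu n) hA)

/-- **(60) from Lemma IV**: if `d/dτ (Ω, A^τ Ω)|_{τ=0} = 0` for every strictly local `A`, then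
`(Ω, A^τ Ω) = (Ω, A Ω)` for every quasi-local `A` and every `τ` (KRS §IV, (70)-(71): the group
law and 6(a) move the derivative to any `τ`; "it is sufficient to verify this for a strictly
local `A` because `|ω(a)| ≤ ‖a‖` and every `a ∈ 𝔄` is the limit in the norm topology of strictly
local elements"). [cite: KastlerRobinsonSwieca1966, §IV (60), (70)-(71)] -/
theorem vev_invariant_of_hasDerivAt (hα : N.IsLocallyGeneratedSymmetry α)
    (hiso : ∀ O₁ O₂ : Set (SpaceTime 3), O₁ ⊆ O₂ → N.alg O₁ ≤ N.alg O₂)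
    (hD : ∀ A : N.H →L[ℂ] N.H, N.IsStrictlyLocal A →
      HasDerivAt (fun τ : ℝ => ⟪N.Ω, α τ A N.Ω⟫_ℂ) 0 0)
    (τ : ℝ) {A : N.H →L[ℂ] N.H} (hA : A ∈ N.quasiLocal) :
    ⟪N.Ω, α τ A N.Ω⟫_ℂ = ⟪N.Ω, A N.Ω⟫_ℂ := by
  -- strictly local operators first
  have hloc : ∀ B : N.H →L[ℂ] N.H, N.IsStrictlyLocal B → ∀ σ : ℝ,
      ⟪N.Ω, α σ B N.Ω⟫_ℂ = ⟪N.Ω, B N.Ω⟫_ℂ := by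
    intro B hB σ
    obtain ⟨L, hBL⟩ := hB
    have hBq : B ∈ N.quasiLocal := N.subset_quasiLocal ⟨L, hBL⟩
    set g : ℝ → ℂ := fun σ => ⟪N.Ω, α σ B N.Ω⟫_ℂ with hg
    have hderiv : ∀ τ₀ : ℝ, HasDerivAt g 0 τ₀ := by
      intro τ₀
      have hB' : N.IsStrictlyLocal (α τ₀ B) := ⟨L, hα.preserves_local τ₀ L B hBL⟩
      have h0 := hD (α τ₀ B) hB'
      have heq : (fun σ : ℝ => ⟪N.Ω, α σ (α τ₀ B) N.Ω⟫_ℂ) = fun σ => g (σ + τ₀) := by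
        funext σ
        simp only [hg, hα.map_add_left σ τ₀ B hBq]
      rw [heq] at h0
      have h0' : HasDerivAt (fun σ : ℝ => g (σ + τ₀)) 0 (τ₀ + -τ₀) := by rwa [add_neg_cancel]
      have h1 := h0'.comp_add_const τ₀ (-τ₀)
      simpa only [neg_add_cancel_right] using h1
    have hdiff : Differentiable ℝ g := fun x => (hderiv x).differentiableAt
    have hconst := is_const_of_deriv_eq_zero hdiff (fun x => (hderiv x).deriv) σ 0
    change g σ = _
    rw [hconst]
    simp [hg, hα.map_zero_left B hBq]
  -- density
  obtain ⟨u, hu, hlim⟩ := mem_closure_iff_seq_limit.mp hA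
  have h1 : Tendsto (fun n => ⟪N.Ω, α τ (u n) N.Ω⟫_ℂ) atTop (𝓝 ⟪N.Ω, α τ A N.Ω⟫_ℂ) := by
    have := hα.tendsto_apply hiso τ (fun n => N.subset_quasiLocal (hu n)) hA hlim
    exact ((continuous_const.inner ((ContinuousLinearMap.apply ℂ N.H N.Ω).continuous)).tendsto
      _).comp this
  have h2 : Tendsto (fun n => ⟪N.Ω, (u n) N.Ω⟫_ℂ) atTop (𝓝 ⟪N.Ω, A N.Ω⟫_ℂ) :=
    ((continuous_const.inner ((ContinuousLinearMap.apply ℂ N.H N.Ω).continuous)).tendsto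
      _).comp hlim
  have h3 : (fun n => ⟪N.Ω, α τ (u n) N.Ω⟫_ℂ) = fun n => ⟪N.Ω, (u n) N.Ω⟫_ℂ :=
    funext fun n => hloc (u n) (hu n) τ
  rw [h3] at h1
  exact tendsto_nhds_unique h1 h2

/-- Invariance of the state gives an isometry on `𝔄 Ω`: `‖A^τ Ω‖ = ‖A Ω‖` (KRS (67)).
[cite: KastlerRobinsonSwieca1966, §IV (67)] -/
theorem norm_apply_vacuum_eq (hα : N.IsLocallyGeneratedSymmetry α)
    (hiso : ∀ O₁ O₂ : Set (SpaceTime 3), O₁ ⊆ O₂ → N.alg O₁ ≤ N.alg O₂)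
    (hinv : ∀ τ : ℝ, ∀ A ∈ N.quasiLocal, ⟪N.Ω, α τ A N.Ω⟫_ℂ = ⟪N.Ω, A N.Ω⟫_ℂ)
    (τ : ℝ) {A : N.H →L[ℂ] N.H} (hA : A ∈ N.quasiLocal) : ‖α τ A N.Ω‖ = ‖A N.Ω‖ := by
  have hsA : star A ∈ N.quasiLocal := N.star_mem_quasiLocal hiso hA
  have key : ⟪α τ A N.Ω, α τ A N.Ω⟫_ℂ = ⟪A N.Ω, A N.Ω⟫_ℂ := by
    rw [← ContinuousLinearMap.adjoint_inner_right, ← ContinuousLinearMap.star_eq_adjoint,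
      ← mul_apply_eq_comp, ← hα.map_star τ A hA,
      ← hα.map_mul τ (star A) hsA A hA, hinv τ _ (N.mul_mem_quasiLocal hiso hsA hA),
      mul_apply_eq_comp, ContinuousLinearMap.star_eq_adjoint,
      ContinuousLinearMap.adjoint_inner_right]
  have h1 := inner_self_eq_norm_sq_to_K (𝕜 := ℂ) (α τ A N.Ω)
  have h2 := inner_self_eq_norm_sq_to_K (𝕜 := ℂ) (A N.Ω)
  rw [key] at h1
  rw [h1] at h2
  have h3 : (‖α τ A N.Ω‖ : ℝ) ^ 2 = ‖A N.Ω‖ ^ 2 := by exact_mod_cast h2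
  exact (pow_left_inj₀ (norm_nonneg _) (norm_nonneg _) two_ne_zero).mp h3

/-- `α_τ` restricted to the quasi-local algebra, as a linear automorphism with inverse `α_{-τ}`.
[cite: KastlerRobinsonSwieca1966, §II assumption 6.] -/
def symmetryEquiv (hα : N.IsLocallyGeneratedSymmetry α)
    (hiso : ∀ O₁ O₂ : Set (SpaceTime 3), O₁ ⊆ O₂ → N.alg O₁ ≤ N.alg O₂) (τ : ℝ) :
    N.quasiLocalAlgebra hiso ≃ₗ[ℂ] N.quasiLocalAlgebra hiso where
  toFun A := ⟨α τ A, hα.maps_quasiLocal τ A A.2⟩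
  invFun A := ⟨α (-τ) A, hα.maps_quasiLocal (-τ) A A.2⟩
  map_add' A B := Subtype.ext (hα.map_add τ A A.2 B B.2)
  map_smul' c A := Subtype.ext (hα.map_smul τ c A A.2)
  left_inv A := Subtype.ext (hα.apply_neg_apply τ A.2)
  right_inv A := Subtype.ext (hα.apply_apply_neg τ A.2)

/-- `symmetryEquiv` acts as `α_τ`. [folklore] -/
@[simp]
theorem coe_symmetryEquiv_apply (hα : N.IsLocallyGeneratedSymmetry α)
    (hiso : ∀ O₁ O₂ : Set (SpaceTime 3), O₁ ⊆ O₂ → N.alg O₁ ≤ N.alg O₂) (τ : ℝ)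
    (A : N.quasiLocalAlgebra hiso) :
    ((hα.symmetryEquiv hiso τ A : N.quasiLocalAlgebra hiso) : N.H →L[ℂ] N.H) = α τ A := rfl

/-- The inverse of `symmetryEquiv` acts as `α_{-τ}`. [folklore] -/
@[simp]
theorem coe_symmetryEquiv_symm_apply (hα : N.IsLocallyGeneratedSymmetry α)
    (hiso : ∀ O₁ O₂ : Set (SpaceTime 3), O₁ ⊆ O₂ → N.alg O₁ ≤ N.alg O₂) (τ : ℝ)
    (A : N.quasiLocalAlgebra hiso) :
    (((hα.symmetryEquiv hiso τ).symm A : N.quasiLocalAlgebra hiso) : N.H →L[ℂ] N.H) =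
      α (-τ) A := rfl

end IsLocallyGeneratedSymmetry

variable (N) in
/-- The GNS map `A ↦ A Ω` on the quasi-local algebra (KRS §IV, (63)-(66): `â = A Ω`).
[cite: KastlerRobinsonSwieca1966, §IV (63)-(66)] -/
def vacuumVector (hiso : ∀ O₁ O₂ : Set (SpaceTime 3), O₁ ⊆ O₂ → N.alg O₁ ≤ N.alg O₂) :
    N.quasiLocalAlgebra hiso →ₗ[ℂ] N.H where
  toFun A := (A : N.H →L[ℂ] N.H) N.Ω
  map_add' _ _ := rfl
  map_smul' _ _ := rfl

/-- `vacuumVector A = A Ω`. [folklore] -/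
@[simp]
theorem vacuumVector_apply (hiso : ∀ O₁ O₂ : Set (SpaceTime 3), O₁ ⊆ O₂ → N.alg O₁ ≤ N.alg O₂)
    (A : N.quasiLocalAlgebra hiso) : N.vacuumVector hiso A = (A : N.H →L[ℂ] N.H) N.Ω := rfl

/-- **The vacuum is cyclic for the quasi-local algebra**: `𝔄 Ω` is dense. From irreducibility
(assumption 1.): the projection onto the closure of `𝔄 Ω` commutes with every strictly local
operator, hence is a scalar, and it fixes `Ω ≠ 0`. (KRS use the GNS space of `ω = (Ω, · Ω)`,
"the cyclic state Ω".) [cite: KastlerRobinsonSwieca1966, §II 1. and §IV (61)-(63)] -/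
theorem denseRange_vacuumVector {m : ℝ} (hN : N.IsKRS m) :
    DenseRange (N.vacuumVector hN.isotony) := by
  set S := N.quasiLocalAlgebra hN.isotony with hS
  set e := N.vacuumVector hN.isotony with he
  set K : Submodule ℂ N.H := LinearMap.range e with hK
  set M : Submodule ℂ N.H := K.topologicalClosure with hM
  haveI : CompleteSpace M := K.isClosed_topologicalClosure.completeSpace_coe
  set P : N.H →L[ℂ] N.H := M.starProjection with hP
  have hKinv : ∀ A ∈ S, ∀ v ∈ K, A v ∈ K := by
    rintro A hA v ⟨B, rfl⟩
    exact ⟨⟨A, hA⟩ * B, rfl⟩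
  have hMinv : ∀ A ∈ S, ∀ v ∈ M, A v ∈ M := by
    intro A hA v hv
    have h1 : Set.MapsTo A (K : Set N.H) (K : Set N.H) := fun v hv => hKinv A hA v hv
    have h2 := h1.closure A.continuous
    have hv' : v ∈ closure (K : Set N.H) := by
      rw [← Submodule.topologicalClosure_coe]; exact hv
    have := h2 hv'
    rw [← Submodule.topologicalClosure_coe] at this
    exact this
  have hMorth : ∀ A ∈ S, ∀ v ∈ Mᗮ, A v ∈ Mᗮ := by
    intro A hA v hv
    rw [Submodule.mem_orthogonal] at hv ⊢
    intro u hu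
    rw [← ContinuousLinearMap.adjoint_inner_left, ← ContinuousLinearMap.star_eq_adjoint]
    exact hv _ (hMinv (star A) (star_mem hA) u hu)
  have hcomm : ∀ A ∈ S, A * P = P * A := by
    intro A hA
    ext x
    rw [mul_apply_eq_comp, mul_apply_eq_comp]
    have hx : A x = A (P x) + A (x - P x) := by
      rw [← map_add, add_sub_cancel]
    have h1 : P (A (P x)) = A (P x) :=
      Submodule.starProjection_eq_self_iff.mpr (hMinv A hA _ (Submodule.starProjection_apply_mem M x))
    have h2 : P (A (x - P x)) = 0 := by
      rw [hP, Submodule.starProjection_apply, Submodule.coe_eq_zero]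
      exact Submodule.orthogonalProjectionOnto_apply_of_mem_orthogonal
        (hMorth A hA _ (Submodule.sub_starProjection_mem_orthogonal x))
    rw [hx, map_add, h1, h2, add_zero]
  obtain ⟨c, hc⟩ := hN.irreducible P fun A hA =>
    hcomm A (StarSubalgebra.le_topologicalClosure _ hA)
  have hΩK : N.Ω ∈ K := ⟨1, by simp [he]⟩
  have hPΩ : P N.Ω = N.Ω :=
    Submodule.starProjection_eq_self_iff.mpr (K.le_topologicalClosure hΩK)
  have hΩ0 : N.Ω ≠ 0 := by
    intro h
    have := hN.norm_vacuum
    rw [h, norm_zero] at this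
    exact zero_ne_one this
  have hc1 : c = 1 := by
    have h1 : c • N.Ω = N.Ω := by
      have := congrArg (fun T : N.H →L[ℂ] N.H => T N.Ω) hc
      simpa [hPΩ] using this.symm
    have h2 : (c - 1) • N.Ω = 0 := by rw [sub_smul, one_smul, h1, sub_self]
    rcases smul_eq_zero.mp h2 with h | h
    · exact sub_eq_zero.mp h
    · exact absurd h hΩ0
  have hM_top : M = ⊤ := by
    refine Submodule.eq_top_iff'.mpr fun x => ?_
    have hPx : P x = x := by rw [hc, hc1, one_smul]; rfl
    rw [← hPx]
    exact Submodule.starProjection_apply_mem M x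
  have hdense : Dense (K : Set N.H) := Submodule.dense_iff_topologicalClosure_eq_top.mpr hM_top
  simpa [DenseRange, hK, LinearMap.coe_range] using hdense

/-- **KRS Theorem, GNS step**: if the vacuum expectation values are invariant,
`(Ω, A^τ Ω) = (Ω, A Ω)` for all `A ∈ 𝔄` (60), then the automorphisms are unitarily implemented:
`U(τ) A Ω := A^τ Ω` is "coherently determined as a unitary operator" (66)-(67) on the dense
subspace `𝔄 Ω`, and (56)-(59) hold. [cite: KastlerRobinsonSwieca1966, §IV (60)-(69)] -/
theorem exists_unitary_implementation {m : ℝ} (hN : N.IsKRS m)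
    (hα : N.IsLocallyGeneratedSymmetry α)
    (hinv : ∀ τ : ℝ, ∀ A ∈ N.quasiLocal, ⟪N.Ω, α τ A N.Ω⟫_ℂ = ⟪N.Ω, A N.Ω⟫_ℂ) :
    ∃ U : ℝ → (N.H →L[ℂ] N.H),
      (∀ τ, U τ ∈ unitary (N.H →L[ℂ] N.H)) ∧
      (∀ σ τ, U (σ + τ) = U σ * U τ) ∧
      (∀ τ, star (U τ) = U (-τ)) ∧
      (∀ τ, U τ N.Ω = N.Ω) ∧
      ∀ τ, ∀ A ∈ N.quasiLocal, α τ A = U τ * A * star (U τ) := by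
  have hiso := hN.isotony
  set S := N.quasiLocalAlgebra hiso with hS
  set e := N.vacuumVector hiso with he
  have hd : DenseRange e := denseRange_vacuumVector hN
  have hnorm : ∀ (τ : ℝ) (A : S), ‖e (hα.symmetryEquiv hiso τ A)‖ = ‖e A‖ := fun τ A =>
    hα.norm_apply_vacuum_eq hiso hinv τ A.2
  set V : ℝ → (N.H ≃ₗᵢ[ℂ] N.H) := fun τ =>
    (hα.symmetryEquiv hiso τ).extendOfIsometry e e hd hd (hnorm τ) with hV
  have hVe : ∀ (τ : ℝ) (A : S), V τ (e A) = e (hα.symmetryEquiv hiso τ A) := fun τ A =>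
    LinearEquiv.extendOfIsometry_eq _ _ _ hd hd (hnorm τ) A
  have hVse : ∀ (τ : ℝ) (A : S), (V τ).symm (e A) = e ((hα.symmetryEquiv hiso τ).symm A) :=
    fun τ A => LinearEquiv.extendOfIsometry_symm_eq _ _ _ hd hd (hnorm τ) A
  set U : ℝ → (N.H →L[ℂ] N.H) := fun τ => ((V τ : N.H ≃ₗᵢ[ℂ] N.H) : N.H →L[ℂ] N.H) with hU
  have hUapp : ∀ (τ : ℝ) (x : N.H), U τ x = V τ x := fun τ x => rfl
  have hUe : ∀ (τ : ℝ) (A : S), U τ ((A : N.H →L[ℂ] N.H) N.Ω) = α τ A N.Ω := fun τ A => by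
    rw [hUapp]; exact hVe τ A
  have hUmem : ∀ τ, U τ ∈ unitary (N.H →L[ℂ] N.H) := fun τ =>
    (Unitary.linearIsometryEquiv.symm (V τ)).2
  -- equality of bounded operators on the dense subspace `𝔄 Ω`
  have hext : ∀ T₁ T₂ : N.H →L[ℂ] N.H,
      (∀ A : S, T₁ ((A : N.H →L[ℂ] N.H) N.Ω) = T₂ ((A : N.H →L[ℂ] N.H) N.Ω)) → T₁ = T₂ := by
    intro T₁ T₂ h
    have := hd.equalizer T₁.continuous T₂.continuous (funext fun A => h A)
    exact ContinuousLinearMap.coeFn_injective this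
  have hstar : ∀ τ, star (U τ) = U (-τ) := by
    intro τ
    rw [hU, LinearIsometryEquiv.star_eq_symm]
    refine hext _ _ fun A => ?_
    change (V τ).symm (e A) = V (-τ) (e A)
    rw [hVse, hVe]
    rfl
  refine ⟨U, hUmem, ?_, hstar, ?_, ?_⟩
  · intro σ τ
    refine hext _ _ fun A => ?_
    rw [mul_apply_eq_comp, hUe, hUe, hα.map_add_left σ τ A A.2]
    exact (hUe σ ⟨α τ A, hα.maps_quasiLocal τ A A.2⟩).symm
  · intro τ
    have := hUe τ 1
    simpa [hα.map_one τ] using this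
  · intro τ A hA
    have h1 : α τ A * U τ = U τ * A := by
      refine hext _ _ fun B => ?_
      rw [mul_apply_eq_comp, mul_apply_eq_comp, hUe, ← mul_apply_eq_comp,
        ← hα.map_mul τ A hA B B.2, ← mul_apply_eq_comp]
      exact (hUe τ ⟨A * B, N.mul_mem_quasiLocal hiso hA B.2⟩).symm
    rw [← h1, mul_assoc, Unitary.mul_star_self_of_mem (hUmem τ), mul_one]

end LocalNetWithCurrent

/-- **The KRS theorem from the vanishing of the order parameter.** If for every strictly local
`A` the function `τ ↦ (Ω, A^τ Ω)` has derivative `0` at `τ = 0` (which is what assumption 6(b)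
and Lemma IV give, (70)-(71)), then the symmetry is unitarily implemented with invariant vacuum,
(56)-(59). [cite: KastlerRobinsonSwieca1966, §IV proof of the Theorem] -/
theorem goldstone_of_hasDerivAt_vev (N : LocalNetWithCurrent) (m : ℝ)
    (α : ℝ → (N.H →L[ℂ] N.H) → (N.H →L[ℂ] N.H)) (hN : N.IsKRS m)
    (hα : N.IsLocallyGeneratedSymmetry α)
    (hD : ∀ A : N.H →L[ℂ] N.H, N.IsStrictlyLocal A →
      HasDerivAt (fun τ : ℝ => ⟪N.Ω, α τ A N.Ω⟫_ℂ) 0 0) :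
    ∃ U : ℝ → (N.H →L[ℂ] N.H),
      (∀ τ, U τ ∈ unitary (N.H →L[ℂ] N.H)) ∧
      (∀ σ τ, U (σ + τ) = U σ * U τ) ∧
      (∀ τ, star (U τ) = U (-τ)) ∧
      (∀ τ, U τ N.Ω = N.Ω) ∧
      ∀ τ, ∀ A ∈ N.quasiLocal, α τ A = U τ * A * star (U τ) :=
  exists_unitary_implementation hN hα fun τ _ hA =>
    hα.vev_invariant_of_hasDerivAt hN.isotony hD τ hA

/-- **Goldstone's theorem (KRS) from Lemma IV**: the Theorem of §IV follows from assumptions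
1.–6. once Lemma IV (`KRSLemmaIV`, the vanishing of the charge commutators in the limit
`R → ∞`) is available. [cite: KastlerRobinsonSwieca1966, §IV (70)-(71)] -/
theorem goldstoneTheorem_of_KRSLemmaIV (h : KRSLemmaIV) : GoldstoneTheorem := by
  intro N m α hN hα
  refine goldstone_of_hasDerivAt_vev N m α hN hα fun A hA => ?_
  obtain ⟨F, hF⟩ := IsChargeTestFamily.exists (δ := 1) one_pos
  exact h.hasDerivAt_vev_zero N m α hN hα hA one_pos hF

end Literature.Barriers.QuantumFields
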